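import Mathlib.MeasureTheory.Integral.Prod
import Literature.MathematicalPhysics.QuantumFieldTheory.TorusChartSpinWaveIntegral
import HarnessLib

/-!
# Gauge fixing of the global rotation: the zero mode of the spin-wave sector integrates out to `2π`

On a finite torus `Λ` (any finite index type with a distinguished site `0`), real fields `φ : Λ → ℝ` are
parametrised by the value `a = φ 0` at the origin and the RELATIVE field `ψ = (φ - φ 0)|_{Λ ∖ 0}`; the map
`(a, ψ) ↦ extZero ψ + a` (`gaugeMap`, extension of `ψ` by `0` at the origin, then the constant shift by `a`) is a
measurable bijection `ℝ × (Λ∖0 → ℝ) → (Λ → ℝ)` preserving Lebesgue measure (`measurePreserving_gaugeEquiv`: it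
is a shear composed with the product decomposition of the pi measure).  Consequently, for a set `S` of fields
and an integrand `f` both invariant under constant shifts `φ ↦ φ + a` (the global `U(1)` rotation of an
`XY`-type model),

  `∫_{φ ∈ S, φ 0 ∈ T} f φ = vol(T) • ∫_{ψ : extZero ψ ∈ S} f (extZero ψ)`

(`setIntegral_inter_eval_zero_mem_eq_smul`).  Applied to the winding sectors `liftDom k` of
`TorusChartSpinWaveDomain.lean` (gradient constraints are shift invariant, `T = [0, 2π)`):
`∫_{liftDom k} f = 2π • ∫_{ψ : extZero ψ ∈ gradDom k} f (extZero ψ)` (`setIntegral_liftDom_eq_smul`) — the zero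
mode of the spin-wave sector is integrated out exactly, leaving an integral over fields pinned at the origin.
-/

noncomputable section

namespace Literature.MathematicalPhysics.QuantumFieldTheory

open scoped BigOperators
open _root_.MeasureTheory _root_.MeasureTheory.Measure Set Real

namespace TorusChart

section Gauge

variable {Λ : Type*} [Zero Λ] [DecidableEq Λ]

/-- The sites other than the origin. [folklore] -/
abbrev Punctured (Λ : Type*) [Zero Λ] : Type _ := {x : Λ // x ≠ 0}

/-- The origin as the unique element of `{x // x = 0}`. [folklore] -/
instance uniqueEqZero : Unique {x : Λ // x = 0} where
  default := ⟨0, rfl⟩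
  uniq := fun x => Subtype.ext x.2

/-- **Extension by zero at the origin** of a relative field. [folklore] -/
def extZero (ψ : Punctured Λ → ℝ) : Λ → ℝ := fun x => if h : x = 0 then 0 else ψ ⟨x, h⟩

/-- `extZero ψ` vanishes at the origin. [folklore] -/
@[simp] theorem extZero_zero (ψ : Punctured Λ → ℝ) : extZero ψ 0 = 0 := by simp [extZero]

/-- `extZero ψ` is `ψ` off the origin. [folklore] -/
theorem extZero_of_ne (ψ : Punctured Λ → ℝ) {x : Λ} (hx : x ≠ 0) : extZero ψ x = ψ ⟨x, hx⟩ := by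
  simp [extZero, hx]

/-- `extZero ψ` at a punctured site. [folklore] -/
@[simp] theorem extZero_coe (ψ : Punctured Λ → ℝ) (x : Punctured Λ) : extZero ψ x = ψ x := by
  rw [extZero_of_ne ψ x.2]

/-- `extZero` is measurable. [folklore] -/
theorem measurable_extZero : Measurable (extZero (Λ := Λ)) := by
  refine measurable_pi_lambda _ fun x => ?_
  by_cases hx : x = 0
  · subst hx; simp only [extZero_zero]; exact measurable_const
  · simp only [extZero_of_ne _ hx]; exact measurable_pi_apply _

/-- **The gauge map** `(a, ψ) ↦ extZero ψ + a`: value `a` at the origin, `ψ + a` elsewhere. [folklore] -/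
def gaugeMap (p : ℝ × (Punctured Λ → ℝ)) : Λ → ℝ := fun x => extZero p.2 x + p.1

/-- The gauge map at the origin. [folklore] -/
@[simp] theorem gaugeMap_apply_zero (p : ℝ × (Punctured Λ → ℝ)) : gaugeMap p 0 = p.1 := by simp [gaugeMap]

/-- The gauge map off the origin. [folklore] -/
theorem gaugeMap_apply_of_ne (p : ℝ × (Punctured Λ → ℝ)) {x : Λ} (hx : x ≠ 0) : gaugeMap p x = p.2 ⟨x, hx⟩ + p.1 := by
  simp [gaugeMap, extZero_of_ne _ hx]

/-- The **shear** `(a, χ) ↦ (a, χ + a)` of `ℝ × (Λ∖0 → ℝ)`. [folklore] -/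
def shear : ℝ × (Punctured Λ → ℝ) ≃ᵐ ℝ × (Punctured Λ → ℝ) where
  toFun p := (p.1, fun x => p.2 x + p.1)
  invFun p := (p.1, fun x => p.2 x - p.1)
  left_inv p := by ext <;> simp
  right_inv p := by ext <;> simp
  measurable_toFun := measurable_fst.prodMk
    (measurable_pi_lambda _ fun x => ((measurable_pi_apply x).comp measurable_snd).add measurable_fst)
  measurable_invFun := measurable_fst.prodMk
    (measurable_pi_lambda _ fun x => ((measurable_pi_apply x).comp measurable_snd).sub measurable_fst)

omit [DecidableEq Λ] in
/-- Unfolding the shear. [folklore] -/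
@[simp] theorem shear_apply (p : ℝ × (Punctured Λ → ℝ)) : shear p = (p.1, fun x => p.2 x + p.1) := rfl

omit [DecidableEq Λ] in
/-- Unfolding the inverse shear. [folklore] -/
@[simp] theorem shear_symm_apply (p : ℝ × (Punctured Λ → ℝ)) : shear.symm p = (p.1, fun x => p.2 x - p.1) := rfl

/-- **The gauge map as a measurable equivalence** `ℝ × (Λ∖0 → ℝ) ≃ᵐ (Λ → ℝ)`: shear, then read the first
coordinate as the constant field on `{0}`, then glue the two pieces (`piEquivPiSubtypeProd`). [folklore] -/
def gaugeEquiv : ℝ × (Punctured Λ → ℝ) ≃ᵐ (Λ → ℝ) :=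
  shear.trans
    (((MeasurableEquiv.piEquivPiSubtypeProd (fun _ : Λ => ℝ) (fun x => x = 0)).trans
      (MeasurableEquiv.prodCongr (MeasurableEquiv.funUnique {x : Λ // x = 0} ℝ)
        (MeasurableEquiv.refl (Punctured Λ → ℝ)))).symm)

/-- **The inverse gauge map**: `φ ↦ (φ 0, (φ - φ 0)|_{Λ∖0})`. [folklore] -/
@[simp] theorem gaugeEquiv_symm_apply (φ : Λ → ℝ) :
    gaugeEquiv.symm φ = (φ 0, fun x : Punctured Λ => φ x - φ 0) := rfl

/-- The inverse gauge map inverts `gaugeMap`. [folklore] -/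
theorem gaugeEquiv_symm_gaugeMap (p : ℝ × (Punctured Λ → ℝ)) : gaugeEquiv.symm (gaugeMap p) = p := by
  rw [gaugeEquiv_symm_apply]
  ext
  · simp
  · simp [gaugeMap]

/-- **The gauge equivalence is the gauge map.** [folklore] -/
@[simp] theorem gaugeEquiv_apply (p : ℝ × (Punctured Λ → ℝ)) : gaugeEquiv p = gaugeMap p := by
  have h := congr_arg gaugeEquiv (gaugeEquiv_symm_gaugeMap p)
  rw [MeasurableEquiv.apply_symm_apply] at h
  exact h.symm

/-- The shear preserves Lebesgue measure. [folklore] -/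
theorem measurePreserving_shear [Fintype Λ] :
    MeasurePreserving (shear (Λ := Λ)) (volume.prod volume) (volume.prod volume) := by
  have h : MeasurePreserving (fun p : ℝ × (Punctured Λ → ℝ) => (p.1, (fun _ : Punctured Λ => p.1) + p.2))
      (volume.prod volume) (volume.prod volume) := by
    refine (MeasurePreserving.id volume).skew_product (g := fun a χ => (fun _ : Punctured Λ => a) + χ) ?_ ?_
    · exact (measurable_pi_lambda _ fun x => measurable_fst).add measurable_snd
    · exact Filter.Eventually.of_forall fun a => (measurePreserving_add_left volume (fun _ : Punctured Λ => a)).map_eq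
  convert h using 1
  funext p
  rw [shear_apply]
  ext x
  · rfl
  · simp [add_comm]

/-- **The gauge map preserves Lebesgue measure**: `(a, ψ) ↦ extZero ψ + a` pushes `vol ⊗ vol` on
`ℝ × (Λ∖0 → ℝ)` to `vol` on `Λ → ℝ`. [folklore] -/
theorem measurePreserving_gaugeEquiv [Fintype Λ] :
    MeasurePreserving (gaugeEquiv (Λ := Λ)) (volume.prod volume) volume := by
  -- Lebesgue measure on `{x // x = 0} → ℝ` does not depend on the `Fintype` instance used to build it
  have hμ : ∀ i1 i2 : Fintype {x : Λ // x = 0},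
      @volume ({x : Λ // x = 0} → ℝ) (@MeasureSpace.pi _ i1 (fun _ => ℝ) fun _ => Real.measureSpace) =
        @volume ({x : Λ // x = 0} → ℝ) (@MeasureSpace.pi _ i2 (fun _ => ℝ) fun _ => Real.measureSpace) := by
    intro i1 i2; rw [Subsingleton.elim i1 i2]
  have h1 := volume_preserving_piEquivPiSubtypeProd (fun _ : Λ => ℝ) (fun x => x = 0)
  have hf : MeasurePreserving (MeasurableEquiv.funUnique {x : Λ // x = 0} ℝ)
      (@volume ({x : Λ // x = 0} → ℝ)
        (@MeasureSpace.pi _ (Subtype.fintype fun x => x = 0) (fun _ => ℝ) fun _ => Real.measureSpace)) volume := by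
    have h := volume_preserving_funUnique {x : Λ // x = 0} ℝ
    rwa [hμ _ (Subtype.fintype fun x => x = 0)] at h
  have h2 := hf.prod (MeasurePreserving.id (volume : Measure (Punctured Λ → ℝ)))
  have h12 : MeasurePreserving
      ((MeasurableEquiv.piEquivPiSubtypeProd (fun _ : Λ => ℝ) (fun x => x = 0)).trans
        (MeasurableEquiv.prodCongr (MeasurableEquiv.funUnique {x : Λ // x = 0} ℝ)
          (MeasurableEquiv.refl (Punctured Λ → ℝ)))) volume (volume.prod volume) :=
    h1.trans h2
  exact measurePreserving_shear.trans (h12.symm _)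

variable {E : Type*} [NormedAddCommGroup E] [NormedSpace ℝ E]

/-- **Gauge fixing of the constant mode.** For a measurable set `S` of fields and an integrand `f` both invariant
under constant shifts `φ ↦ φ + a`, and any set `T` of values at the origin,
`∫_{φ ∈ S, φ 0 ∈ T} f = vol(T) • ∫_{ψ : extZero ψ ∈ S} f (extZero ψ)`. [folklore] -/
theorem setIntegral_inter_eval_zero_mem_eq_smul [Fintype Λ] {S : Set (Λ → ℝ)} (hS : MeasurableSet S)
    (hSinv : ∀ (φ : Λ → ℝ) (a : ℝ), (fun x => φ x + a) ∈ S ↔ φ ∈ S) (f : (Λ → ℝ) → E)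
    (hf : ∀ (φ : Λ → ℝ) (a : ℝ), f (fun x => φ x + a) = f φ) (T : Set ℝ) :
    ∫ φ in {φ | φ 0 ∈ T} ∩ S, f φ =
      (volume T).toReal • ∫ ψ in {ψ : Punctured Λ → ℝ | extZero ψ ∈ S}, f (extZero ψ) := by
  set B : Set (Punctured Λ → ℝ) := {ψ | extZero ψ ∈ S} with hB
  have hBm : MeasurableSet B := hS.preimage measurable_extZero
  -- pull back along the gauge equivalence
  have hpre : (gaugeEquiv (Λ := Λ)) ⁻¹' ({φ | φ 0 ∈ T} ∩ S) = T ×ˢ B := by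
    ext p
    simp only [Set.mem_preimage, Set.mem_inter_iff, Set.mem_setOf_eq, Set.mem_prod, gaugeEquiv_apply,
      gaugeMap_apply_zero, hB]
    exact and_congr_right fun _ => by rw [show gaugeMap p = fun x => extZero p.2 x + p.1 from rfl, hSinv]
  have h := (measurePreserving_gaugeEquiv (Λ := Λ)).setIntegral_preimage_emb
    (gaugeEquiv (Λ := Λ)).measurableEmbedding f ({φ | φ 0 ∈ T} ∩ S)
  rw [← h, hpre]
  have hfg : (fun p : ℝ × (Punctured Λ → ℝ) => f (gaugeEquiv p)) = fun p => f (extZero p.2) := by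
    funext p
    rw [gaugeEquiv_apply, show gaugeMap p = fun x => extZero p.2 x + p.1 from rfl, hf]
  have hsnd := integral_fun_snd (μ := volume.restrict T) (ν := volume.restrict B)
    (fun ψ : Punctured Λ → ℝ => f (extZero ψ))
  rw [hfg, ← Measure.prod_restrict, hsnd, measureReal_restrict_apply_univ, measureReal_def]

end Gauge

/-! ## The zero mode of the winding sectors -/

section LiftDom

variable {Λ : Type*} [AddCommGroup Λ] {d : ℕ} (F : TorusChart Λ d)

/-- The **gradient domain** of the winding sector `k`: the shift-invariant part of the constraints of
`liftDom k` (seam-corrected gradients are principal values). [folklore] -/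
def gradDom (k : Fin d → ℤ) : Set (Λ → ℝ) :=
  {φ | ∀ x i, F.d₀ φ x i + F.seam (twoPiSeam k) x i ∈ Set.Ioc (-π) π}

/-- `liftDom k` is the gradient domain cut by the gauge condition `φ 0 ∈ [0, 2π)`. [folklore] -/
theorem liftDom_eq_inter_gradDom (k : Fin d → ℤ) :
    F.liftDom k = {φ : Λ → ℝ | φ 0 ∈ Set.Ico 0 (2 * π)} ∩ F.gradDom k := rfl

/-- The gradient domain is invariant under constant shifts. [folklore] -/
theorem add_const_mem_gradDom_iff (k : Fin d → ℤ) (φ : Λ → ℝ) (a : ℝ) :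
    (fun x => φ x + a) ∈ F.gradDom k ↔ φ ∈ F.gradDom k := by
  have hd : ∀ x i, F.d₀ (fun y => φ y + a) x i = F.d₀ φ x i := fun x i => by simp only [d₀_apply]; ring
  simp only [gradDom, Set.mem_setOf_eq, hd]

/-- The gradient domain is measurable. [folklore] -/
theorem measurableSet_gradDom [Finite Λ] (k : Fin d → ℤ) : MeasurableSet (F.gradDom k) := by
  have h2 : ∀ (x : Λ) (i : Fin d),
      MeasurableSet {φ : Λ → ℝ | F.d₀ φ x i + F.seam (twoPiSeam k) x i ∈ Set.Ioc (-π) π} := fun x i => by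
    have hm : Measurable fun φ : Λ → ℝ => F.d₀ φ x i + F.seam (twoPiSeam k) x i :=
      ((measurable_pi_apply (x + F.gen i)).sub (measurable_pi_apply x)).add_const _
    exact measurableSet_Ioc.preimage hm
  have : F.gradDom k = ⋂ x : Λ, ⋂ i : Fin d, {φ : Λ → ℝ | F.d₀ φ x i + F.seam (twoPiSeam k) x i ∈ Set.Ioc (-π) π} := by
    ext φ; simp only [gradDom, Set.mem_setOf_eq, Set.mem_iInter]
  rw [this]
  exact MeasurableSet.iInter fun x => MeasurableSet.iInter fun i => h2 x i

/-- **The zero mode of a winding sector integrates out to `2π`.** For an integrand invariant under constant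
shifts (the global `U(1)` rotation),
`∫_{liftDom k} f = 2π • ∫_{ψ : extZero ψ ∈ gradDom k} f (extZero ψ)`. [folklore] -/
theorem setIntegral_liftDom_eq_smul [Fintype Λ] [DecidableEq Λ] {E : Type*} [NormedAddCommGroup E]
    [NormedSpace ℝ E] (k : Fin d → ℤ) (f : (Λ → ℝ) → E)
    (hf : ∀ (φ : Λ → ℝ) (a : ℝ), f (fun x => φ x + a) = f φ) :
    ∫ φ in F.liftDom k, f φ =
      (2 * π) • ∫ ψ in {ψ : Punctured Λ → ℝ | extZero ψ ∈ F.gradDom k}, f (extZero ψ) := by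
  rw [liftDom_eq_inter_gradDom,
    setIntegral_inter_eval_zero_mem_eq_smul (F.measurableSet_gradDom k) (F.add_const_mem_gradDom_iff k) f hf
      (Set.Ico 0 (2 * π)),
    Real.volume_Ico, ENNReal.toReal_ofReal (by linarith [Real.two_pi_pos]), sub_zero]

end LiftDom

end TorusChart

end Literature.MathematicalPhysics.QuantumFieldTheory

end
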